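import Literature.AlgebraicTopology.Homotopy.SerreFibrationInvariantCycles
import Literature.AlgebraicTopology.SingularHomology.CompactSupport
import Literature.AlgebraicTopology.SingularHomology.UniversalCoefficientsField
import HarnessLib

/-!
# Deligne's invariant cycle theorem over bases of dimension `≤ 1` needs no Lefschetz class

Topic `Literature/AlgebraicTopology/Homotopy`. PROOF FILE (theorems only; no definition, no named
fact). Companion of `SerreFibrationInvariantCycles`: there, for a Serre fibration `p : E → B` over a
base of the weak homotopy type of a Hausdorff CW complex, every flat family `y_b ∈ Hᵏ(p⁻¹b; K)` of
fibre classes is the family of restrictions of one class of `E` PROVIDED a class `η ∈ H²(E; K)` has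
the hard Lefschetz property on the fibres (Deligne 1968, Voisin II Thm. 4.15 / 4.18: the Lefschetz
class kills the differentials `d_r`, `r ≥ 2`, of the Leray spectral sequence). The first step of
that proof, `SerreInvariantCycles.exists_extension_oneSkeleton`, extends the family over the
`1`-skeleton of a CW model with NO hypothesis: `d_r`, `r ≥ 2`, raises the base degree by `r`, so
nothing obstructs in base degrees `≤ 1` (Leray `E₂^{p,q} = 0` for `p ≥ 2` when the base is a
`1`-complex). This file records the consequences:

* `skel_one_eq_univ` — a CW complex without cells of dimension `> 1` is its own `1`-skeleton;
* `exists_class_of_flat_cw_of_cells_le_one` — over a Hausdorff CW complex WITHOUT CELLS OF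
  DIMENSION `> 1`, every flat family is the family of restrictions of a class of `E`, for every
  Serre fibration and every field `K`, with no Lefschetz class;
* `exists_class_of_flat_of_cells_le_one`, `exists_class_piece_of_cells_le_one` — the same over a
  base (or a sub-base `C ⊆ B`) weakly equivalent to such a complex (pull back to the CW model,
  Spanier 9.2.17, and propagate along paths, exactly as in `SerreInvariantCycles.exists_class_of_flat`);
* `exists_class_of_flat_of_exhaustion` — **the same over a base exhausted by an increasing sequence
  of open sets `V₀ ⊆ V₁ ⊆ ⋯`, `⋃ Vₘ = B`, each contained in a sub-base `Mₘ ⊇ Vₘ` weakly equivalent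
  to a Hausdorff CW complex without cells of dimension `> 1`** — the form met by the complex points
  of a smooth affine curve (Andreotti–Frankel: `S(ℂ)` is exhausted by compact sublevel sets homotopy
  equivalent to finite `1`-complexes; `HodgeTheory/AndreottiFrankelHomotopyType`). Proof: over a
  field, `Hᵏ(E; K) = Hom_K(H_k(E; K), K)` (universal coefficients, Hatcher Thm. 3.2) and a class
  with prescribed Kronecker values on the images of the fibres exists as soon as the prescription
  respects the linear relations among fibre cycles in `H_k(E; K)`; a relation involves finitely many
  fibres and, singular homology having compact supports (Hatcher Prop. 3.33), already holds in some
  `H_k(p⁻¹Vₘ; K)`, where it is respected because the family is the restriction of a class of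
  `p⁻¹Mₘ`. No `lim¹` term and no finiteness is needed.

Consumer: the invariant cycle theorem for ALL smooth proper families over smooth affine curves
(`HodgeTheory/InvariantClassesFromTotalSpaceCurveBase`), hence the flat-section form of the
variational Hodge conjecture from its global-class form without Deligne's *Hodge II* Thm. 4.1.1.

## References

* C. Voisin, *Hodge Theory and Complex Algebraic Geometry II*, CUP (2003), §4.2.3–4.3.1, Lemma 4.17,
  Thm. 4.18. [VoisinHodgeII2003]
* E. H. Spanier, *Algebraic Topology*, Springer (1981), Ch. 9 Sec. 2 Thm. 17. [Spanier1981]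
* A. Hatcher, *Algebraic Topology*, CUP (2002), §3.1 Thm. 3.2 (p. 198), Prop. 3.33 (p. 244),
  §3.F Thm. 3F.8. [HatcherAT2002]
-/

noncomputable section

open Set Function Metric CategoryTheory
open scoped Topology unitInterval
open Literature.AlgebraicTopology.SingularHomology Literature.Algebra.Homology

namespace Literature.AlgebraicTopology.Homotopy

universe u

namespace SerreInvariantCycles

open _root_.Topology RelCWComplex CellsDirectSum SerreFlat

/-! ### Over a CW complex without cells of dimension `> 1` -/

section CWBase

variable (K : Type u) [Field K]
variable {X : Type u} [TopologicalSpace X] [T2Space X] [CWComplex (univ : Set X)]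
variable {E : Type u} [TopologicalSpace E] {p : E → X} (hp : IsSerreFibration p)
  {k : ℕ} (y : ∀ x : X, singularCohomology K K ↥(p ⁻¹' {x}) k)
  (hy : ∀ x₀ : X, ∃ V ∈ 𝓝 x₀, ∃ g : singularCohomology K K ↥(p ⁻¹' V) k, ∀ (x : X) (hx : x ∈ V),
    singularCohomology.map K K (subsetInclusion (fibre_subset_preimage hx)) k g = y x)

/-- **A CW complex without cells of dimension `> 1` is its own `1`-skeleton** (`X = X¹`, Mathlib's
`skeletonLT 2`): every point lies in an open cell, necessarily of dimension `≤ 1`.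
[cite: HatcherAT2002, Ch. 0 p. 5] -/
theorem skel_one_eq_univ (h1 : ∀ n, 1 < n → IsEmpty (cell (univ : Set X) n)) :
    (skeletonLT (univ : Set X) (((1 : ℕ) : ℕ∞) + 1) : Set X) = univ := by
  refine eq_univ_of_forall fun x => ?_
  have hx : x ∈ ⋃ (n : ℕ) (j : cell (univ : Set X) n), openCell n j := by
    rw [CWComplex.iUnion_openCell_eq_complex]; exact mem_univ x
  simp only [mem_iUnion] at hx
  obtain ⟨m, j, hj⟩ := hx
  have hm : m ≤ 1 := by
    by_contra hm
    exact (h1 m (by omega)).false j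
  exact SetLike.mem_coe.2 (CWComplex.mem_skeletonLT_iff.2 ⟨m, by exact_mod_cast Nat.lt_succ_of_le hm, j, hj⟩)

include hp hy in
/-- **Flat families over a Hausdorff CW complex without cells of dimension `> 1` come from the
total space, with no Lefschetz hypothesis**: for a Serre fibration `p : E → X` over such a complex
and a field `K`, every flat family `y_x ∈ Hᵏ(p⁻¹x; K)` is the family of fibre restrictions of one
`z ∈ Hᵏ(E; K)`. The extension over the `1`-skeleton (`exists_extension_oneSkeleton`: Mayer–Vietoris
for the open collar of `X⁰` and the small `1`-cells, rigidity along arcs) is already a class of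
`E = p⁻¹X¹`, with the right restrictions over the `0`-cells, hence everywhere (every point is joined
to a `0`-cell; rigidity of flat families along paths). [cite: VoisinHodgeII2003, §4.3.1 and Lemma 4.17]
[cite: HatcherAT2002, §3.1 pp. 203–204] -/
theorem exists_class_of_flat_cw_of_cells_le_one (h1 : ∀ n, 1 < n → IsEmpty (cell (univ : Set X) n)) :
    ∃ z : singularCohomology K K E k, ∀ x : X,
      singularCohomology.map K K (subsetIncl (p ⁻¹' {x})) k z = y x := by
  obtain ⟨w, hw⟩ := exists_extension_oneSkeleton K hp y hy
  -- `E₁ = p⁻¹X¹` is all of `E`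
  have htot : tot p 1 = univ := by
    change p ⁻¹' (skeletonLT (univ : Set X) (((1 : ℕ) : ℕ∞) + 1) : Set X) = univ
    rw [skel_one_eq_univ h1, preimage_univ]
  let eT : ↥(tot p 1) ≃ₜ E := (Homeomorph.setCongr htot).trans (Homeomorph.Set.univ E)
  have heT : (eT : C(↥(tot p 1), E)) = subsetIncl (tot p 1) := ContinuousMap.ext fun _ => rfl
  obtain ⟨z, hz⟩ := (bijective_cohomologyMap_homeomorph K eT k).2 w
  rw [heT] at hz
  refine ⟨z, fun x => ?_⟩
  -- at the `0`-cells
  have h0 : ∀ (v : X) (hv : v ∈ (skeletonLT (univ : Set X) ((1 : ℕ) : ℕ∞) : Set X)),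
      singularCohomology.map K K (subsetIncl (p ⁻¹' {v})) k z = y v := by
    intro v hv
    have hv1 : p ⁻¹' {v} ⊆ tot p 1 :=
      fibre_subset_preimage (skeletonLT_mono (by exact_mod_cast Nat.le_succ 1) hv)
    have hfac : subsetIncl (p ⁻¹' {v}) = (subsetIncl (tot p 1)).comp (subsetInclusion hv1) :=
      ContinuousMap.ext fun _ => rfl
    rw [hfac, singularCohomology.map_comp, ModuleCat.comp_apply, hz]
    exact hw v hv
  -- propagate from a `0`-cell
  obtain ⟨v, hv, ⟨γ⟩⟩ := exists_joined_zeroCell x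
  have e0 : (γ.symm : C(I, X)) 0 = v := γ.symm.source
  have e1 : (γ.symm : C(I, X)) 1 = x := γ.symm.target
  have hstart := (resE_eq_iff_of_eq K y z e0).2 (h0 v hv)
  exact (resE_eq_iff_of_eq K y z e1).1 (propagate_univ K hp z y hy (γ.symm : C(I, X)) hstart 1)

end CWBase

/-! ### Over a base of the weak homotopy type of a CW complex without cells of dimension `> 1` -/

section General

variable (K : Type u) [Field K]
variable {B : Type u} [TopologicalSpace B] {E : Type u} [TopologicalSpace E] {p : E → B}
  (hp : IsSerreFibration p)
  {X : Type u} [TopologicalSpace X] [T2Space X] [CWComplex (univ : Set X)]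
  (h : C(X, B)) (hh : IsWeakHomotopyEquiv h)
  {k : ℕ} (y : ∀ b : B, singularCohomology K K ↥(p ⁻¹' {b}) k)
  (hy : ∀ b₀ : B, ∃ V ∈ 𝓝 b₀, ∃ g : singularCohomology K K ↥(p ⁻¹' V) k, ∀ (b : B) (hb : b ∈ V),
    singularCohomology.map K K (subsetInclusion (fibre_subset_preimage hb)) k g = y b)

include hp hh hy in
/-- `exists_class_of_flat_of_cells_le_one` with the pullback `h^*E → X` abstracted: any Serre
fibration `p' : E' → X` with a weak equivalence `snd : E' → E` over `h` identifying the fibres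
(verbatim the reduction `SerreInvariantCycles.exists_class_of_flat_aux`, without the Lefschetz data).
[cite: VoisinHodgeII2003, Thm. 4.18] [cite: Spanier1981, Ch. 9, Sec. 2, Thm. 17] -/
theorem exists_class_of_flat_aux_of_cells_le_one {E' : Type u} [TopologicalSpace E'] {p' : E' → X}
    (hp' : IsSerreFibration p') (snd : C(E', E)) (hsnd : IsWeakHomotopyEquiv snd)
    (hpsnd : ∀ e, p (snd e) = h (p' e))
    (φ : ∀ x : X, ↥(p' ⁻¹' {x}) ≃ₜ ↥(p ⁻¹' {h x}))
    (hφ : ∀ (x : X) (e : ↥(p' ⁻¹' {x})), ((φ x e : ↥(p ⁻¹' {h x})) : E) = snd e.1)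
    (h1 : ∀ n, 1 < n → IsEmpty (cell (univ : Set X) n)) :
    ∃ z : singularCohomology K K E k, ∀ b : B,
      singularCohomology.map K K (subsetIncl (p ⁻¹' {b})) k z = y b := by
  have hφfac : ∀ x : X, snd.comp (subsetIncl (p' ⁻¹' {x})) =
      (subsetIncl (p ⁻¹' {h x})).comp (φ x : C(↥(p' ⁻¹' {x}), ↥(p ⁻¹' {h x}))) :=
    fun x => ContinuousMap.ext fun e => (hφ x e).symm
  -- the family on `E'`
  let y' : ∀ x : X, singularCohomology K K ↥(p' ⁻¹' {x}) k := fun x =>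
    singularCohomology.map K K (φ x : C(↥(p' ⁻¹' {x}), ↥(p ⁻¹' {h x}))) k (y (h x))
  have hy' : ∀ x₀ : X, ∃ V ∈ 𝓝 x₀, ∃ g : singularCohomology K K ↥(p' ⁻¹' V) k, ∀ (x : X) (hx : x ∈ V),
      singularCohomology.map K K (subsetInclusion (fibre_subset_preimage hx)) k g = y' x := by
    intro x₀
    obtain ⟨V, hV, g, hg⟩ := hy (h x₀)
    have hmemV : ∀ e : ↥(p' ⁻¹' (h ⁻¹' V)), snd e.1 ∈ p ⁻¹' V := fun e => by
      have he : h (p' e.1) ∈ V := e.2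
      show p (snd e.1) ∈ V
      rw [hpsnd]; exact he
    let sV : C(↥(p' ⁻¹' (h ⁻¹' V)), ↥(p ⁻¹' V)) :=
      ⟨fun e => ⟨snd e.1, hmemV e⟩, (snd.continuous.comp continuous_subtype_val).subtype_mk _⟩
    refine ⟨h ⁻¹' V, h.continuous.continuousAt.preimage_mem_nhds hV, singularCohomology.map K K sV k g,
      fun x hx => ?_⟩
    have hfac : sV.comp (subsetInclusion (fibre_subset_preimage hx)) =
        (subsetInclusion (fibre_subset_preimage hx : p ⁻¹' {h x} ⊆ p ⁻¹' V)).comp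
          (φ x : C(↥(p' ⁻¹' {x}), ↥(p ⁻¹' {h x}))) :=
      ContinuousMap.ext fun e => Subtype.ext (hφ x _).symm
    change _ = singularCohomology.map K K (φ x : C(↥(p' ⁻¹' {x}), ↥(p ⁻¹' {h x}))) k (y (h x))
    rw [← ModuleCat.comp_apply, ← singularCohomology.map_comp, hfac, singularCohomology.map_comp,
      ModuleCat.comp_apply, hg (h x) hx]
  -- the theorem over the CW base, and descent of the class along `snd`
  obtain ⟨z', hz'⟩ := exists_class_of_flat_cw_of_cells_le_one K hp' y' hy' h1
  obtain ⟨z, rfl⟩ := (bijective_cohomologyMap_of_isWeakHomotopyEquiv K snd hsnd k).2 z'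
  refine ⟨z, fun b => ?_⟩
  have hat : ∀ x : X, singularCohomology.map K K (subsetIncl (p ⁻¹' {h x})) k z = y (h x) := by
    intro x
    apply (bijective_cohomologyMap_homeomorph K (φ x) k).1
    rw [← ModuleCat.comp_apply, ← singularCohomology.map_comp, ← hφfac x, singularCohomology.map_comp,
      ModuleCat.comp_apply]
    exact hz' x
  -- every point of `B` is joined to some `h x`
  obtain ⟨q, hq⟩ := hh.1.2 (ZerothHomotopy.mk b)
  induction q using Quotient.inductionOn with
  | h x =>
    have hx : ZerothHomotopy.mk (h x) = ZerothHomotopy.mk b := by rw [← hq]; rfl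
    obtain ⟨γ⟩ : Joined (h x) b := Quotient.exact hx
    have e0 : (γ : C(I, B)) 0 = h x := γ.source
    have e1 : (γ : C(I, B)) 1 = b := γ.target
    have hstart := (resE_eq_iff_of_eq K y z e0).2 (hat x)
    exact (resE_eq_iff_of_eq K y z e1).1 (propagate_univ K hp z y hy (γ : C(I, B)) hstart 1)

include hp hh hy in
/-- **Flat families over a base weakly equivalent to a Hausdorff CW complex without cells of
dimension `> 1` come from the total space** (no Lefschetz class): pull back to the CW model
(`h^*E → E` is a weak equivalence, Spanier 9.2.17), apply `exists_class_of_flat_cw_of_cells_le_one`,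
and propagate along paths from the points `h x`. [cite: VoisinHodgeII2003, Thm. 4.18 and Lemma 4.17]
[cite: Spanier1981, Ch. 9, Sec. 2, Thm. 17] -/
theorem exists_class_of_flat_of_cells_le_one (h1 : ∀ n, 1 < n → IsEmpty (cell (univ : Set X) n)) :
    ∃ z : singularCohomology K K E k, ∀ b : B,
      singularCohomology.map K K (subsetIncl (p ⁻¹' {b})) k z = y b := by
  have hp' : IsSerreFibration (Function.Pullback.fst : (⇑h).Pullback p → X) := hp.pullback_fst h
  have hsnd := hp.isWeakHomotopyEquiv_pullback_snd h hh
  have hmemφ : ∀ (x : X) (e : ↥((Function.Pullback.fst : (⇑h).Pullback p → X) ⁻¹' {x})),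
      e.1.snd ∈ p ⁻¹' {h x} := fun x e => by
    have he : e.1.fst = x := e.2
    have h2 : h e.1.fst = p e.1.snd := e.1.2
    rw [he] at h2
    exact h2.symm
  refine exists_class_of_flat_aux_of_cells_le_one K hp h hh y hy hp' _ hsnd (fun e => e.2.symm)
    (fun x =>
      { toFun := fun e => ⟨e.1.snd, hmemφ x e⟩
        invFun := fun e => ⟨⟨(x, e.1), (e.2 : p e.1 = h x).symm⟩, rfl⟩
        left_inv := fun e => by
          apply Subtype.ext; apply Subtype.ext; apply Prod.ext
          · exact (e.2 : e.1.fst = x).symm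
          · rfl
        right_inv := fun e => rfl
        continuous_toFun :=
          ((continuous_snd.comp continuous_subtype_val).comp continuous_subtype_val).subtype_mk _
        continuous_invFun := ((continuous_const.prodMk continuous_subtype_val).subtype_mk _).subtype_mk _ })
    (fun x e => rfl) h1

end General

/-! ### Over a sub-base with such a CW model -/

section Piece

variable (K : Type u) [Field K]
variable {B : Type u} [TopologicalSpace B] {E : Type u} [TopologicalSpace E] {p : E → B}
  (hp : IsSerreFibration p)
  {k : ℕ} (y : ∀ b : B, singularCohomology K K ↥(p ⁻¹' {b}) k)
  (hy : ∀ b₀ : B, ∃ V ∈ 𝓝 b₀, ∃ g : singularCohomology K K ↥(p ⁻¹' V) k, ∀ (b : B) (hb : b ∈ V),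
    singularCohomology.map K K (subsetInclusion (fibre_subset_preimage hb)) k g = y b)

include hp hy in
/-- The theorem over one piece `C ⊆ B` of the base with a CW model without cells of dimension
`> 1`: a class on `p⁻¹C` restricting to `y` on the fibres over `C` (the restricted Serre fibration
`p| : p⁻¹C → C`, whose fibres are those of `p`; verbatim `SerreInvariantCycles.exists_class_piece`
without the Lefschetz data). [cite: VoisinHodgeII2003, Thm. 4.18] [cite: Spanier1981, Ch. 9, Sec. 2, Thm. 17] -/
theorem exists_class_piece_of_cells_le_one (C : Set B) {X : Type u} [TopologicalSpace X] [T2Space X]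
    [CWComplex (univ : Set X)] (h1 : ∀ n, 1 < n → IsEmpty (cell (univ : Set X) n))
    (h : C(X, ↥C)) (hh : IsWeakHomotopyEquiv h) :
    ∃ z : singularCohomology K K ↥(p ⁻¹' C) k, ∀ (b : B) (hb : b ∈ C),
      singularCohomology.map K K (subsetInclusion (fibre_subset_preimage hb)) k z = y b := by
  have hpC : IsSerreFibration (C.restrictPreimage p) := hp.restrictPreimage C
  -- the fibres of `p|` are the fibres of `p`
  obtain ⟨e, he⟩ : ∃ e : ∀ x : ↥C, ↥((C.restrictPreimage p) ⁻¹' {x}) ≃ₜ ↥(p ⁻¹' {(x : B)}),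
      ∀ (x : ↥C) (u : ↥((C.restrictPreimage p) ⁻¹' {x})), ((e x u : ↥(p ⁻¹' {(x : B)})) : E) = u.1.1 :=
    ⟨fun x =>
      { toFun := fun u => ⟨u.1.1, congrArg Subtype.val u.2⟩
        invFun := fun v =>
          ⟨⟨v.1, Set.mem_preimage.2 (mem_of_eq_of_mem (v.2 : p v.1 = (x : B)) x.2)⟩, Subtype.ext v.2⟩
        left_inv := fun u => rfl
        right_inv := fun v => rfl
        continuous_toFun := (continuous_subtype_val.comp continuous_subtype_val).subtype_mk _
        continuous_invFun := (continuous_subtype_val.subtype_mk _).subtype_mk _ }, fun x u => rfl⟩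
  -- the data over `C`
  let yC : ∀ x : ↥C, singularCohomology K K ↥((C.restrictPreimage p) ⁻¹' {x}) k := fun x =>
    singularCohomology.map K K (e x : C(↥((C.restrictPreimage p) ⁻¹' {x}), ↥(p ⁻¹' {(x : B)}))) k (y x)
  have hyC : ∀ x₀ : ↥C, ∃ V ∈ 𝓝 x₀, ∃ g : singularCohomology K K ↥((C.restrictPreimage p) ⁻¹' V) k,
      ∀ (x : ↥C) (hx : x ∈ V),
        singularCohomology.map K K (subsetInclusion (fibre_subset_preimage hx)) k g = yC x := by
    intro x₀
    obtain ⟨V, hV, g, hg⟩ := hy x₀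
    let sV : C(↥((C.restrictPreimage p) ⁻¹' (Subtype.val ⁻¹' V)), ↥(p ⁻¹' V)) :=
      ⟨fun u => ⟨u.1.1, u.2⟩, (continuous_subtype_val.comp continuous_subtype_val).subtype_mk _⟩
    refine ⟨Subtype.val ⁻¹' V, continuous_subtype_val.continuousAt.preimage_mem_nhds hV,
      singularCohomology.map K K sV k g, fun x hx => ?_⟩
    have hfac : sV.comp (subsetInclusion (fibre_subset_preimage hx)) =
        (subsetInclusion (fibre_subset_preimage hx : p ⁻¹' {(x : B)} ⊆ p ⁻¹' V)).comp
          (e x : C(↥((C.restrictPreimage p) ⁻¹' {x}), ↥(p ⁻¹' {(x : B)}))) :=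
      ContinuousMap.ext fun u => Subtype.ext (he x _).symm
    change _ = singularCohomology.map K K
      (e x : C(↥((C.restrictPreimage p) ⁻¹' {x}), ↥(p ⁻¹' {(x : B)}))) k (y x)
    rw [← ModuleCat.comp_apply, ← singularCohomology.map_comp, hfac, singularCohomology.map_comp,
      ModuleCat.comp_apply, hg x hx]
  obtain ⟨z, hz⟩ := exists_class_of_flat_of_cells_le_one K hpC h hh yC hyC h1
  refine ⟨z, fun b hb => ?_⟩
  have hx := hz ⟨b, hb⟩
  have hfac : subsetInclusion (fibre_subset_preimage hb) =
      (subsetIncl ((C.restrictPreimage p) ⁻¹' {(⟨b, hb⟩ : ↥C)})).comp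
        ((e ⟨b, hb⟩).symm : C(↥(p ⁻¹' {b}), ↥((C.restrictPreimage p) ⁻¹' {(⟨b, hb⟩ : ↥C)}))) := by
    refine ContinuousMap.ext fun v => Subtype.ext ?_
    have h1 := he ⟨b, hb⟩ ((e ⟨b, hb⟩).symm v)
    rw [Homeomorph.apply_symm_apply] at h1
    exact h1
  rw [hfac, singularCohomology.map_comp, ModuleCat.comp_apply, hx]
  exact map_symm_map_homeomorph K (e ⟨b, hb⟩) k (y b)

end Piece

/-! ### Over a base exhausted by open sets inside pieces with such CW models -/

section Exhaustion

variable (K : Type u) [Field K]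

/-- Linear algebra over a field: a functional `Y` on `D` that kills `ker Ψ` factors through
`Ψ : D → H` — descend `Y` to `D ⧸ ker Ψ ≅ range Ψ` and extend from `range Ψ` to `H`. [folklore] -/
private theorem exists_linearMap_comp_eq_of_ker_le {D H : Type*} [AddCommGroup D] [Module K D]
    [AddCommGroup H] [Module K H] (Ψ : D →ₗ[K] H) (Y : D →ₗ[K] K)
    (hker : LinearMap.ker Ψ ≤ LinearMap.ker Y) :
    ∃ l : H →ₗ[K] K, l ∘ₗ Ψ = Y := by
  let l₁ : LinearMap.range Ψ →ₗ[K] K :=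
    ((LinearMap.ker Ψ).liftQ Y hker) ∘ₗ Ψ.quotKerEquivRange.symm.toLinearMap
  obtain ⟨g, hg⟩ := LinearMap.exists_extend l₁
  refine ⟨g, LinearMap.ext fun d => ?_⟩
  have h1 : g (Ψ d) = l₁ ⟨Ψ d, LinearMap.mem_range_self Ψ d⟩ := by
    rw [← hg]; rfl
  rw [LinearMap.comp_apply, h1]
  change (LinearMap.ker Ψ).liftQ Y hker (Ψ.quotKerEquivRange.symm ⟨Ψ d, _⟩) = Y d
  rw [LinearMap.quotKerEquivRange_symm_apply_image]
  rfl

variable {B : Type u} [TopologicalSpace B] {E : Type u} [TopologicalSpace E] {p : E → B}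
  (hp : IsSerreFibration p)
  {k : ℕ} (y : ∀ b : B, singularCohomology K K ↥(p ⁻¹' {b}) k)
  (hy : ∀ b₀ : B, ∃ V ∈ 𝓝 b₀, ∃ g : singularCohomology K K ↥(p ⁻¹' V) k, ∀ (b : B) (hb : b ∈ V),
    singularCohomology.map K K (subsetInclusion (fibre_subset_preimage hb)) k g = y b)

include hp hy in
/-- **Flat families over an exhausted base come from the total space.** Let `p : E → B` be a Serre
fibration, `K` a field, and `B = ⋃ₘ Vₘ` an increasing union of open sets with `Vₘ ⊆ Mₘ` for
sub-bases `Mₘ` each weakly equivalent to a Hausdorff CW complex without cells of dimension `> 1`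
(e.g. the complex points of a smooth affine curve, exhausted by the compact sublevel sets of a
proper Morse function of index `≤ 1`, Andreotti–Frankel). Then every flat family
`y_b ∈ Hᵏ(p⁻¹b; K)` is the family of fibre restrictions of one class `z ∈ Hᵏ(E; K)`. Proof: by
universal coefficients over the field (`Hᵏ = Hom_K(H_k, K)`, Hatcher Thm. 3.2) it suffices to find
a functional on `H_k(E; K)` with the values `⟨y_b, ·⟩` on the images of the fibres, i.e. to check
that `∑_b ⟨y_b, c_b⟩ = 0` whenever `∑_b ι_{b*} c_b = 0` in `H_k(E; K)` (finite sums); such a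
relation already holds in some `H_k(p⁻¹Vₘ; K)` (compact supports, Hatcher Prop. 3.33), where the
values are those of the class of `p⁻¹Mₘ` given by `exists_class_piece_of_cells_le_one`
(naturality of the Kronecker pairing). [cite: HatcherAT2002, §3.1 Thm. 3.2 (p. 198) and Prop. 3.33]
[cite: VoisinHodgeII2003, Thm. 4.18 and Lemma 4.17] -/
theorem exists_class_of_flat_of_exhaustion (V : ℕ → Set B) (hVo : ∀ m, IsOpen (V m))
    (hVm : Monotone V) (hV : ⋃ m, V m = univ) (M : ℕ → Set B) (hVM : ∀ m, V m ⊆ M m)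
    (hCW : ∀ m, ∃ (X : Type u) (_ : TopologicalSpace X) (_ : T2Space X)
      (_ : CWComplex (univ : Set X)), (∀ n, 1 < n → IsEmpty (cell (univ : Set X) n)) ∧
        ∃ h : C(X, ↥(M m)), IsWeakHomotopyEquiv h) :
    ∃ z : singularCohomology K K E k, ∀ b : B,
      singularCohomology.map K K (subsetIncl (p ⁻¹' {b})) k z = y b := by
  classical
  -- (1) the classes over the pieces `M m`
  have hz : ∀ m, ∃ z : singularCohomology K K ↥(p ⁻¹' M m) k, ∀ (b : B) (hb : b ∈ M m),
      singularCohomology.map K K (subsetInclusion (fibre_subset_preimage hb)) k z = y b := by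
    intro m
    obtain ⟨X, _, _, _, h1, h, hh⟩ := hCW m
    exact exists_class_piece_of_cells_le_one K hp y hy (M m) h1 h hh
  choose zM hzM using hz
  -- every base point lies in some `V m`
  have hex : ∀ b : B, ∃ m, b ∈ V m := fun b => by
    have hb : b ∈ ⋃ m, V m := by rw [hV]; exact mem_univ b
    exact mem_iUnion.1 hb
  choose mb hmb using hex
  -- (2) the direct sum of the fibre homologies and its two maps
  let F : B → Type u := fun b => singularHomology K K ↥(p ⁻¹' {b}) k
  let Ψ : (DirectSum B fun b => F b) →ₗ[K] singularHomology K K E k :=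
    DirectSum.toModule K B (singularHomology K K E k)
      fun b => (singularHomology.map K K (subsetIncl (p ⁻¹' {b})) k).hom
  let Y : (DirectSum B fun b => F b) →ₗ[K] K :=
    DirectSum.toModule K B K fun b => kroneckerPairing K K ↥(p ⁻¹' {b}) k (y b)
  have hΨof : ∀ (b : B) (c : F b), Ψ (DirectSum.of F b c) =
      (singularHomology.map K K (subsetIncl (p ⁻¹' {b})) k).hom c := fun b c => by
    change Ψ (DirectSum.lof K B F b c) = _
    exact DirectSum.toModule_lof K b c
  have hYof : ∀ (b : B) (c : F b), Y (DirectSum.of F b c) =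
      kroneckerPairing K K ↥(p ⁻¹' {b}) k (y b) c := fun b c => by
    change Y (DirectSum.lof K B F b c) = _
    exact DirectSum.toModule_lof K b c
  -- (3) the relations among fibre cycles are respected
  have hker : LinearMap.ker Ψ ≤ LinearMap.ker Y := by
    intro d hd
    rw [LinearMap.mem_ker] at hd ⊢
    -- the fibres involved lie over `V m₀`
    set s : Finset B := DFinsupp.support d with hs
    let m₀ : ℕ := s.sup mb
    have hm₀ : ∀ b ∈ s, b ∈ V m₀ := fun b hb => hVm (Finset.le_sup hb) (hmb b)
    -- the open exhaustion `W j = p⁻¹V_{m₀+j}` of `E`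
    let W : ℕ → Set E := fun j => p ⁻¹' V (m₀ + j)
    have hWo : ∀ j, IsOpen (W j) := fun j => (hVo _).preimage hp.continuous
    have hWm : Monotone W := fun i j hij => preimage_mono (hVm (Nat.add_le_add_left hij m₀))
    have hWu : ⋃ j, W j = univ := by
      refine eq_univ_of_forall fun e => mem_iUnion.2 ⟨mb (p e), ?_⟩
      exact hVm (Nat.le_add_left _ _) (hmb (p e))
    -- the relation, as a class `γ` of `p⁻¹V_{m₀}`
    let ι₁ : ∀ b : B, singularHomology K K ↥(p ⁻¹' {b}) k →ₗ[K] singularHomology K K ↥(W 0) k :=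
      fun b => if hb : b ∈ V (m₀ + 0) then
        (singularHomology.map K K (subsetInclusion (fibre_subset_preimage hb : p ⁻¹' {b} ⊆ W 0)) k).hom
      else 0
    have hι₁ : ∀ (b : B) (hb : b ∈ s) (c : F b), ι₁ b c = (singularHomology.map K K
        (subsetInclusion (fibre_subset_preimage (hm₀ b hb) : p ⁻¹' {b} ⊆ W 0)) k).hom c := by
      intro b hb c
      simp only [ι₁, dif_pos (show b ∈ V (m₀ + 0) from hm₀ b hb)]
    let γ : singularHomology K K ↥(W 0) k := ∑ b ∈ s, ι₁ b (d b)
    -- `γ ↦ Ψ d = 0` in `H_k(E)`, read in `H_k(↥univ)`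
    have hd' : Ψ d = ∑ b ∈ s, (singularHomology.map K K (subsetIncl (p ⁻¹' {b})) k).hom (d b) := by
      conv_lhs => rw [← DirectSum.sum_support_of d]
      rw [map_sum]
      exact Finset.sum_congr rfl fun b _ => hΨof b (d b)
    let u : C(E, ↥(univ : Set E)) := ((Homeomorph.Set.univ E).symm : C(E, ↥(univ : Set E)))
    have hγ0 : singularHomology.map K K (subsetInclusion (hWu ▸ subset_iUnion W 0 : W 0 ⊆ univ)) k γ = 0 := by
      have hfac : ∀ (b : B) (hb : b ∈ s), (subsetInclusion (hWu ▸ subset_iUnion W 0 : W 0 ⊆ univ)).comp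
          (subsetInclusion (fibre_subset_preimage (hm₀ b hb) : p ⁻¹' {b} ⊆ W 0)) =
          u.comp (subsetIncl (p ⁻¹' {b})) := fun b hb => ContinuousMap.ext fun _ => rfl
      change (singularHomology.map K K (subsetInclusion (hWu ▸ subset_iUnion W 0 : W 0 ⊆ univ)) k).hom
        (∑ b ∈ s, ι₁ b (d b)) = 0
      rw [map_sum]
      have hterm : ∀ b ∈ s, (singularHomology.map K K
          (subsetInclusion (hWu ▸ subset_iUnion W 0 : W 0 ⊆ univ)) k).hom (ι₁ b (d b)) =
          (singularHomology.map K K u k).hom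
            ((singularHomology.map K K (subsetIncl (p ⁻¹' {b})) k).hom (d b)) := by
        intro b hb
        rw [hι₁ b hb, ← ModuleCat.comp_apply, ← singularHomology.map_comp, hfac b hb,
          singularHomology.map_comp, ModuleCat.comp_apply]
      rw [Finset.sum_congr rfl hterm, ← map_sum, ← hd', hd, map_zero]
    obtain ⟨m, hm⟩ := singularHomology.exists_map_eq_zero_of_iUnion W hWo hWm hWu k γ hγ0
    -- over `M m₁`, `m₁ = m₀ + m`, the family is the restriction of the class `zM m₁`
    set m₁ := m₀ + m with hm₁
    have hWM : W m ⊆ p ⁻¹' M m₁ := preimage_mono (hVM m₁)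
    have hbM : ∀ b ∈ s, b ∈ M m₁ := fun b hb => hVM m₁ (hVm (Nat.le_add_right m₀ m) (hm₀ b hb))
    have hYd : Y d = ∑ b ∈ s, kroneckerPairing K K ↥(p ⁻¹' {b}) k (y b) (d b) := by
      conv_lhs => rw [← DirectSum.sum_support_of d]
      rw [map_sum]
      exact Finset.sum_congr rfl fun b _ => hYof b (d b)
    have hterm : ∀ b ∈ s, kroneckerPairing K K ↥(p ⁻¹' {b}) k (y b) (d b) =
        kroneckerPairing K K ↥(p ⁻¹' M m₁) k (zM m₁)
          ((singularHomology.map K K (subsetInclusion hWM) k).hom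
            ((singularHomology.map K K (subsetInclusion (hWm (Nat.zero_le m))) k).hom (ι₁ b (d b)))) := by
      intro b hb
      have hfac : (subsetInclusion hWM).comp ((subsetInclusion (hWm (Nat.zero_le m))).comp
          (subsetInclusion (fibre_subset_preimage (hm₀ b hb) : p ⁻¹' {b} ⊆ W 0))) =
          subsetInclusion (fibre_subset_preimage (hbM b hb)) := ContinuousMap.ext fun _ => rfl
      rw [← hzM m₁ b (hbM b hb), kroneckerPairing_map, hι₁ b hb]
      change kroneckerPairing K K ↥(p ⁻¹' M m₁) k (zM m₁)
        ((singularHomology.map K K (subsetInclusion (fibre_subset_preimage (hbM b hb))) k).hom (d b)) = _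
      rw [← hfac, singularHomology.map_comp, singularHomology.map_comp, ModuleCat.comp_apply,
        ModuleCat.comp_apply]
    rw [hYd, Finset.sum_congr rfl hterm, ← map_sum, ← map_sum, ← map_sum]
    change kroneckerPairing K K ↥(p ⁻¹' M m₁) k (zM m₁)
      ((singularHomology.map K K (subsetInclusion hWM) k).hom
        ((singularHomology.map K K (subsetInclusion (hWm (Nat.zero_le m))) k).hom γ)) = 0
    have hm' : (singularHomology.map K K (subsetInclusion (hWm (Nat.zero_le m))) k).hom γ = 0 := hm
    rw [hm', map_zero, map_zero]
  -- (4) the functional on `H_k(E; K)` and the class `z`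
  obtain ⟨l, hl⟩ := exists_linearMap_comp_eq_of_ker_le K Ψ Y hker
  obtain ⟨z, hz⟩ := (kroneckerPairing_bijective_of_field K E k).2 l
  refine ⟨z, fun b => ?_⟩
  apply (kroneckerPairing_bijective_of_field K ↥(p ⁻¹' {b}) k).1
  refine LinearMap.ext fun c => ?_
  rw [kroneckerPairing_map]
  change kroneckerPairing K K E k z ((singularHomology.map K K (subsetIncl (p ⁻¹' {b})) k).hom c) = _
  rw [hz, ← hΨof b c, ← LinearMap.comp_apply, hl, hYof b c]

end Exhaustion

end SerreInvariantCycles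

end Literature.AlgebraicTopology.Homotopy

end
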